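import Literature.NumberTheory.EllipticCurves.ZpExtensionEisensteinDVRSettingH5bReductionProofs
import Literature.NumberTheory.EllipticCurves.ZpExtensionEisensteinDVRSettingResidualCompatProofs
import Literature.NumberTheory.EllipticCurves.ZpExtensionEisensteinDVRSettingSelmerCompatProofs
import Literature.NumberTheory.GaloisCohomology.Howard2004.PropagateTowerProofs
import HarnessLib

/-!
# Howard's H.5(b) for the curve's Eisenstein setting is a tower-level-`0` statement: the level lift of the
# `v ∈ S` clauses (theorems only)

`Proofs` file (theorems only; no definition, no named fact, no instance, no notation, no `sorry`).  Topic
`NumberTheory/EllipticCurves` (D1 road of cell `pub/bsd-print-x9`, seat `bsd-line-x10b-p1-w8` g3, the `k = 0` assembler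
lineage; consumer of x9-p1-w3's generic `Howard2004/PropagateTowerProofs` — «the residual propagated Selmer structure is
the same at every level of a tower» — instantiated on the curve's Eisenstein `DVRSetting`).

Howard's H.5(b) [arXiv:1202.6340 p. 7, L96–97] concerns ONE residual module `T̄ = E_K[p]` with the condition `F̄`
propagated from `T_𝔮`.  In the level-wise typing (`DVRSetting.SatisfiesH.h5b : ∀ k, H5b (T^{(k)}) …`, and the `hfin`
hypothesis of `WeierstrassCurve.eisensteinDVRSetting_h5b_of`: `∀ k, ∀ v ∈ S, (θ_v ∘ transport_v)(F̄_k(σ v)) = F̄_k(v)`)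
the clause is asked at every tower level `k` (`T^{(k)} = E_K[p^{k+1}] ⊗ A_{m,k+1}(ψ)`, presentation
`π̄_k : T^{(k)} ↠ E_K[p]`, `θ_k = τ_*`).  All the LANDED clauses — x9-p1-w3's `eisensteinDVRSetting_h5b_clause_zero_of_mem`
/ `…_of_not_decomp_le` (`v ∈ S ∖ {p}`), x10b-p1-w8's `eisensteinDVRSetting_h5b_clause_zero_of_mem_of_nonanomalous`
(`v ∣ p`) — are at tower level `0`.  This file closes the gap BY NAME: for the curve's Eisenstein setting the three
compatibilities of `PropagateTowerProofs` are in the tree —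
* `πbar_red`: `π̄_k ∘ red_k = π̄_{k+1}` (`eisensteinDVRSetting_πbar_red`, `…ResidualCompatProofs`);
* `θ_eq`: one `θ = τ_*` at all levels (`eisensteinDVRSetting_θ_eq`, `rfl`);
* `cond_red`: `H¹(red_{k,v})` maps `F_𝔮` at level `k+1` ONTO `F_𝔮` at level `k` at EVERY place, for `K` totally complex
  (`eisensteinDVRSetting_cond_red`, `…SelmerCompatProofs`) —
so:
* **`WeierstrassCurve.eisensteinDVRSetting_propagateStructure_eq_zero`** — `F̄_k = F̄_0` (the residual structure propagated
  from level `k` IS the one propagated from level `0`), any conjugation datum;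
* `WeierstrassCurve.residualTauGeomTorsion_thetaH1_eq_zero` — `(θ_k)_* = (θ_0)_*` on `H¹(K_v, Tw E_K[p])`;
* **`WeierstrassCurve.eisensteinDVRSetting_h5b_clause_of_zero`** — the `hfin` summand at `(k, v)` from the one at `(0, v)`
  (LITERALLY the conclusion shape of the level-`0` clause files, any conjugation datum `cd`, place `cd.σ • v`);
* **`WeierstrassCurve.eisensteinDVRSetting_h5b_hfin_of_zero`** — the whole `hfin` hypothesis of
  `eisensteinDVRSetting_h5b_of` (canonical datum `ConjugationDatum.ofLifts σ … τ …`, all `k`, all `v ∈ S`) from its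
  level-`0` slice;
* **`WeierstrassCurve.eisensteinDVRSetting_h5b_of_zero`** — `SatisfiesH.h5b` at every level from the level-`0` clauses at
  `v ∈ S` (`σ`-stable `S`; = `eisensteinDVRSetting_h5b_of` ∘ the lift).
The statements carry the CONSUMER PREAMBLE of `ZpExtensionEisensteinDVRSetting`.  No summit statement is proved; BSD is
not proved by any of this.

References: [Howard2004HeegnerKolyvagin] §1.3 H.5(b) (arXiv:1202.6340 p. 7, L96–97), Def. 1.1.3 (propagation), §1.6
(arXiv p. 11 L13–38, p. 12 L29–55: `F` on `T^{(k)}` propagated from `T`), Def. 3.1.2; [MazurRubinMemoirs2004] Def. 1.1.1,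
Example 1.1.2; [SerreGaloisCohomology1997] I §2.2.
-/

set_option autoImplicit false

noncomputable section

open Function NumberField IsDedekindDomain Field
open scoped NumberField ContRepresentation TensorProduct Classical

namespace WeierstrassCurve

open Literature.NumberTheory.EllipticCurves Literature.NumberTheory.GaloisRepresentations
open Literature.NumberTheory.GaloisRepresentations.DiscreteGaloisModule
open Literature.NumberTheory.GaloisCohomology.Howard2004
open Literature.NumberTheory.EllipticCurves.ZpExtension (EisensteinLevel)

variable {K : Type} [Field K] [NumberField K] (W : WeierstrassCurve ℚ) [W.IsElliptic] {p : ℕ} [hp : Fact p.Prime]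
  (κ : ZpExtension K p) {m : ℕ} (hm : 1 ≤ m)
  (S : Finset (HeightOneSpectrum (𝓞 K)))
  (hpS : ∀ v : HeightOneSpectrum (𝓞 K), ((p : ℕ) : 𝓞 K) ∈ v.asIdeal → v ∈ S)
  (hbad : ∀ v : HeightOneSpectrum (𝓞 K), v ∉ S → ((p : ℕ) : 𝓞 K) ∉ v.asIdeal → (W.baseChange K).HasGoodReductionAt v)
  (L : Set (HeightOneSpectrum (𝓞 K)))
  (hL : letI := IwasawaAlgebra.isLocalRing_quotient_X_pow_add_C p hm
    L ⊆ (W.eisensteinTower κ hm).degreeTwoPrimes p)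
  (hLS : ∀ v ∈ L, v ∉ S)
  (jbar : AlgebraicClosure K →+* ℂ)

/-! ## §1 The residual propagated structure `F̄` is the same at every tower level -/

section AnyDatum

variable (cd : ConjugationDatum K)
  (D : letI := IwasawaAlgebra.isLocalRing_quotient_X_pow_add_C p hm
    ∀ k, DualityDatum p cd ((W.eisensteinTower κ hm).ρ k) (IwasawaAlgebra.EisensteinCoeff p m (k + 1)))
  (fs : letI := IwasawaAlgebra.isLocalRing_quotient_X_pow_add_C p hm
    ∀ (k : ℕ) (n : Finset (HeightOneSpectrum (𝓞 K))) (v : HeightOneSpectrum (𝓞 K)),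
      galoisCohomology ((W.eisensteinLevelQuot κ hm k n).toLocal (Sum.inr v)) 1 →+
        SingularQuotient (GaloisRep.toLocal v (W.eisensteinLevelQuot κ hm k n)) ⊗[ℤ] Gell v)

set_option synthInstance.maxHeartbeats 80000 in
/-- **`F̄_{k+1} = F̄_k`**: the residual Selmer structures on `E_K[p]` propagated from two consecutive levels of the curve's
Eisenstein setting coincide (`K` totally complex) — `IsQuotientBy.propagateStructure_eq_of_comp` fed with `πbar_red` and
`cond_red`. [cite: Howard2004HeegnerKolyvagin, Def. 1.1.3 and §1.6 (arXiv p. 5 L93–99, p. 12 L29–55)] -/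
theorem eisensteinDVRSetting_propagateStructure_succ_eq [NumberField.IsTotallyComplex K] (k : ℕ) :
    letI := IwasawaAlgebra.isDomain_quotient_X_pow_add_C p hm
    letI := IwasawaAlgebra.isDiscreteValuationRing_quotient_X_pow_add_C p hm
    haveI := IwasawaAlgebra.EisensteinCoeff.isLocalRing_succ p hm
    letI := IwasawaAlgebra.EisensteinCoeff.algebraOfSpecSucc p m
    haveI := W.isScalarTower_algebraOfSpecSucc (K := K) (p := p) (m := m)
    letI := W.residueModuleSucc (K := K) (p := p) hm
    (W.isQuotientBy_eisensteinDVRSetting_πbar κ hm S hpS hbad L hL hLS jbar cd D fs (k + 1)).propagateStructure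
        (W.eisensteinTowerTriple κ hm S hpS hbad L hL hLS (k + 1)).cond =
      (W.isQuotientBy_eisensteinDVRSetting_πbar κ hm S hpS hbad L hL hLS jbar cd D fs k).propagateStructure
        (W.eisensteinTowerTriple κ hm S hpS hbad L hL hLS k).cond := by
  letI := IwasawaAlgebra.isDomain_quotient_X_pow_add_C p hm
  letI := IwasawaAlgebra.isDiscreteValuationRing_quotient_X_pow_add_C p hm
  haveI := IwasawaAlgebra.EisensteinCoeff.isLocalRing_succ p hm
  letI := IwasawaAlgebra.EisensteinCoeff.algebraOfSpecSucc p m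
  haveI := W.isScalarTower_algebraOfSpecSucc (K := K) (p := p) (m := m)
  letI := W.residueModuleSucc (K := K) (p := p) hm
  exact (W.isQuotientBy_eisensteinDVRSetting_πbar κ hm S hpS hbad L hL hLS jbar cd D fs (k + 1)).propagateStructure_eq_of_comp
    (W.isQuotientBy_eisensteinDVRSetting_πbar κ hm S hpS hbad L hL hLS jbar cd D fs k)
    ((W.eisensteinTower κ hm).red k).toAddMonoidHom (fun g x ↦ (W.eisensteinTower κ hm).red_equivariant k g x)
    (fun x ↦ (W.eisensteinDVRSetting_πbar_red κ hm S hpS hbad L hL hLS jbar cd D fs k x).symm)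
    (W.eisensteinTowerTriple κ hm S hpS hbad L hL hLS (k + 1)).cond (W.eisensteinTowerTriple κ hm S hpS hbad L hL hLS k).cond
    (fun v ↦ W.eisensteinDVRSetting_cond_red κ hm S hpS hbad L hL hLS jbar cd D fs k v)

set_option synthInstance.maxHeartbeats 80000 in
/-- **`F̄_k = F̄_0`: the residual propagated structure of the curve's Eisenstein setting is the same at every tower
level** (`K` totally complex; induction on `k` along `eisensteinDVRSetting_propagateStructure_succ_eq`).
[cite: Howard2004HeegnerKolyvagin, §1.3 H.5(b) (arXiv p. 7, L96–97), Def. 1.1.3 and §1.6 (arXiv p. 12 L29–55)] -/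
theorem eisensteinDVRSetting_propagateStructure_eq_zero [NumberField.IsTotallyComplex K] (k : ℕ) :
    letI := IwasawaAlgebra.isDomain_quotient_X_pow_add_C p hm
    letI := IwasawaAlgebra.isDiscreteValuationRing_quotient_X_pow_add_C p hm
    haveI := IwasawaAlgebra.EisensteinCoeff.isLocalRing_succ p hm
    letI := IwasawaAlgebra.EisensteinCoeff.algebraOfSpecSucc p m
    haveI := W.isScalarTower_algebraOfSpecSucc (K := K) (p := p) (m := m)
    letI := W.residueModuleSucc (K := K) (p := p) hm
    (W.isQuotientBy_eisensteinDVRSetting_πbar κ hm S hpS hbad L hL hLS jbar cd D fs k).propagateStructure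
        (W.eisensteinTowerTriple κ hm S hpS hbad L hL hLS k).cond =
      (W.isQuotientBy_eisensteinDVRSetting_πbar κ hm S hpS hbad L hL hLS jbar cd D fs 0).propagateStructure
        (W.eisensteinTowerTriple κ hm S hpS hbad L hL hLS 0).cond := by
  induction k with
  | zero => rfl
  | succ k ih => exact (W.eisensteinDVRSetting_propagateStructure_succ_eq κ hm S hpS hbad L hL hLS jbar cd D fs k).trans ih

omit [W.IsElliptic] in
/-- **`(θ_k)_* = (θ_0)_*` on `H¹(K_v, Tw E_K[p])`**: the H.5(a) data `residualTauGeomTorsion` of all levels have the same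
underlying involution `τ_*` (the cell's `θ_eq`), hence the same map on local cohomology.
[cite: Howard2004HeegnerKolyvagin, §1.3 H.5(a)–(b) (arXiv p. 7, L93–97)] -/
theorem residualTauGeomTorsion_thetaH1_eq_zero (k : ℕ) (v : NumberField.Place K) :
    letI := W.residueModuleSucc (K := K) (p := p) hm
    (W.residualTauGeomTorsion (p := p) cd hm (k := k + 1) k.succ_pos).thetaH1 v =
      (W.residualTauGeomTorsion (p := p) cd hm (k := 0 + 1) (Nat.succ_pos 0)).thetaH1 v :=
  letI := W.residueModuleSucc (K := K) (p := p) hm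
  (W.residualTauGeomTorsion (p := p) cd hm (k := k + 1) k.succ_pos).thetaH1_eq_of_forall_eq
    (W.residualTauGeomTorsion (p := p) cd hm (k := 0 + 1) (Nat.succ_pos 0)) (fun _ ↦ rfl) v

/-! ## §2 The `hfin` summand of `eisensteinDVRSetting_h5b_of` at level `k` from the one at level `0` -/

set_option synthInstance.maxHeartbeats 80000 in
/-- **The H.5(b) clause at a place is the same at every tower level.**  For the curve's Eisenstein setting with ANY
conjugation datum `cd` (`K` totally complex) and a finite place `v`: if `(θ_v ∘ transport_v)(F̄_0(σ v)) = F̄_0(v)` at tower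
level `0` — the conclusion of `eisensteinDVRSetting_h5b_clause_zero_of_mem` / `…_of_not_decomp_le` /
`…_of_nonanomalous` — then `(θ_v ∘ transport_v)(F̄_k(σ v)) = F̄_k(v)` at every tower level `k` (the `(k, v)` summand of the
`hfin` hypothesis of `eisensteinDVRSetting_h5b_of`).
[cite: Howard2004HeegnerKolyvagin, §1.3 H.5(b) (arXiv p. 7, L96–97) and §1.6 (arXiv p. 12 L29–55)]
[cite: MazurRubinMemoirs2004, Def. 1.1.1 and Example 1.1.2] -/
theorem eisensteinDVRSetting_h5b_clause_of_zero [NumberField.IsTotallyComplex K] {v : HeightOneSpectrum (𝓞 K)}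
    (h0 :
    letI := IwasawaAlgebra.isDomain_quotient_X_pow_add_C p hm
    letI := IwasawaAlgebra.isDiscreteValuationRing_quotient_X_pow_add_C p hm
    haveI := IwasawaAlgebra.EisensteinCoeff.isLocalRing_succ p hm
    letI := IwasawaAlgebra.EisensteinCoeff.algebraOfSpecSucc p m
    haveI := W.isScalarTower_algebraOfSpecSucc (K := K) (p := p) (m := m)
    letI := W.residueModuleSucc (K := K) (p := p) hm
    AddSubgroup.map
        (((W.residualTauGeomTorsion (p := p) cd hm (k := 0 + 1) (Nat.succ_pos 0)).thetaH1 (Sum.inr v)).comp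
          (cd.transportH1 ((W.baseChange K).torsionGaloisModule (p : ℤ)) v))
        (((W.isQuotientBy_eisensteinDVRSetting_πbar κ hm S hpS hbad L hL hLS jbar cd D fs 0).propagateStructure
          (W.eisensteinTowerTriple κ hm S hpS hbad L hL hLS 0).cond) (Sum.inr (cd.σ • v))) =
      ((W.isQuotientBy_eisensteinDVRSetting_πbar κ hm S hpS hbad L hL hLS jbar cd D fs 0).propagateStructure
        (W.eisensteinTowerTriple κ hm S hpS hbad L hL hLS 0).cond) (Sum.inr v))
    (k : ℕ) :
    letI := IwasawaAlgebra.isDomain_quotient_X_pow_add_C p hm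
    letI := IwasawaAlgebra.isDiscreteValuationRing_quotient_X_pow_add_C p hm
    haveI := IwasawaAlgebra.EisensteinCoeff.isLocalRing_succ p hm
    letI := IwasawaAlgebra.EisensteinCoeff.algebraOfSpecSucc p m
    haveI := W.isScalarTower_algebraOfSpecSucc (K := K) (p := p) (m := m)
    letI := W.residueModuleSucc (K := K) (p := p) hm
    AddSubgroup.map
        (((W.residualTauGeomTorsion (p := p) cd hm (k := k + 1) k.succ_pos).thetaH1 (Sum.inr v)).comp
          (cd.transportH1 ((W.baseChange K).torsionGaloisModule (p : ℤ)) v))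
        (((W.isQuotientBy_eisensteinDVRSetting_πbar κ hm S hpS hbad L hL hLS jbar cd D fs k).propagateStructure
          (W.eisensteinTowerTriple κ hm S hpS hbad L hL hLS k).cond) (Sum.inr (cd.σ • v))) =
      ((W.isQuotientBy_eisensteinDVRSetting_πbar κ hm S hpS hbad L hL hLS jbar cd D fs k).propagateStructure
        (W.eisensteinTowerTriple κ hm S hpS hbad L hL hLS k).cond) (Sum.inr v) := by
  letI := IwasawaAlgebra.isDomain_quotient_X_pow_add_C p hm
  letI := IwasawaAlgebra.isDiscreteValuationRing_quotient_X_pow_add_C p hm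
  haveI := IwasawaAlgebra.EisensteinCoeff.isLocalRing_succ p hm
  letI := IwasawaAlgebra.EisensteinCoeff.algebraOfSpecSucc p m
  haveI := W.isScalarTower_algebraOfSpecSucc (K := K) (p := p) (m := m)
  letI := W.residueModuleSucc (K := K) (p := p) hm
  rw [W.eisensteinDVRSetting_propagateStructure_eq_zero κ hm S hpS hbad L hL hLS jbar cd D fs k,
    W.residualTauGeomTorsion_thetaH1_eq_zero (p := p) hm cd k (Sum.inr v)]
  exact h0

end AnyDatum

/-! ## §3 The canonical conjugation datum: `hfin` and `SatisfiesH.h5b` from the level-`0` clauses at `v ∈ S` -/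

section OfLifts

variable (σ : K ≃ₐ[ℚ] K) (hσ₁ : σ ≠ 1) (hσ : σ * σ = 1) (τ : AlgebraicClosure K ≃+* AlgebraicClosure K)
  (hτ : IsLiftOfAut σ τ) (hτ₂ : Function.Involutive τ)
  (D : letI := IwasawaAlgebra.isLocalRing_quotient_X_pow_add_C p hm
    ∀ k, DualityDatum p (ConjugationDatum.ofLifts σ hσ₁ hσ τ hτ hτ₂) ((W.eisensteinTower κ hm).ρ k)
      (IwasawaAlgebra.EisensteinCoeff p m (k + 1)))
  (fs : letI := IwasawaAlgebra.isLocalRing_quotient_X_pow_add_C p hm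
    ∀ (k : ℕ) (n : Finset (HeightOneSpectrum (𝓞 K))) (v : HeightOneSpectrum (𝓞 K)),
      galoisCohomology ((W.eisensteinLevelQuot κ hm k n).toLocal (Sum.inr v)) 1 →+
        SingularQuotient (GaloisRep.toLocal v (W.eisensteinLevelQuot κ hm k n)) ⊗[ℤ] Gell v)

set_option synthInstance.maxHeartbeats 80000 in
/-- **The `hfin` hypothesis of `eisensteinDVRSetting_h5b_of` from its level-`0` slice** (canonical conjugation datum
`ConjugationDatum.ofLifts σ … τ …`, `K` totally complex): if for every `v ∈ S` the clause
`(θ_v ∘ transport_v)(F̄_0(σ v)) = F̄_0(v)` holds at tower level `0`, it holds at every tower level `k`.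
[cite: Howard2004HeegnerKolyvagin, §1.3 H.5(b) (arXiv p. 7, L96–97) and §1.6 (arXiv p. 12 L29–55)] -/
theorem eisensteinDVRSetting_h5b_hfin_of_zero [NumberField.IsTotallyComplex K]
    (hfin0 :
    letI := IwasawaAlgebra.isDomain_quotient_X_pow_add_C p hm
    letI := IwasawaAlgebra.isDiscreteValuationRing_quotient_X_pow_add_C p hm
    haveI := IwasawaAlgebra.EisensteinCoeff.isLocalRing_succ p hm
    letI := IwasawaAlgebra.EisensteinCoeff.algebraOfSpecSucc p m
    haveI := W.isScalarTower_algebraOfSpecSucc (K := K) (p := p) (m := m)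
    letI := W.residueModuleSucc (K := K) (p := p) hm
      ∀ v ∈ S,
        (((W.isQuotientBy_eisensteinDVRSetting_πbar κ hm S hpS hbad L hL hLS jbar (ConjugationDatum.ofLifts σ hσ₁ hσ τ hτ hτ₂) D fs 0).propagateStructure (W.eisensteinTowerTriple κ hm S hpS hbad L hL hLS 0).cond) (Sum.inr (σ • v))).map
            (((W.residualTauGeomTorsion (p := p) (ConjugationDatum.ofLifts σ hσ₁ hσ τ hτ hτ₂) hm (k := 0 + 1) (Nat.succ_pos 0)).thetaH1 (Sum.inr v)).comp
              ((ConjugationDatum.ofLifts σ hσ₁ hσ τ hτ hτ₂).transportH1 ((W.baseChange K).torsionGaloisModule (p : ℤ)) v)) =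
          ((W.isQuotientBy_eisensteinDVRSetting_πbar κ hm S hpS hbad L hL hLS jbar (ConjugationDatum.ofLifts σ hσ₁ hσ τ hτ hτ₂) D fs 0).propagateStructure (W.eisensteinTowerTriple κ hm S hpS hbad L hL hLS 0).cond) (Sum.inr v)) :
    letI := IwasawaAlgebra.isDomain_quotient_X_pow_add_C p hm
    letI := IwasawaAlgebra.isDiscreteValuationRing_quotient_X_pow_add_C p hm
    haveI := IwasawaAlgebra.EisensteinCoeff.isLocalRing_succ p hm
    letI := IwasawaAlgebra.EisensteinCoeff.algebraOfSpecSucc p m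
    haveI := W.isScalarTower_algebraOfSpecSucc (K := K) (p := p) (m := m)
    letI := W.residueModuleSucc (K := K) (p := p) hm
      ∀ k, ∀ v ∈ S,
        (((W.isQuotientBy_eisensteinDVRSetting_πbar κ hm S hpS hbad L hL hLS jbar (ConjugationDatum.ofLifts σ hσ₁ hσ τ hτ hτ₂) D fs k).propagateStructure (W.eisensteinTowerTriple κ hm S hpS hbad L hL hLS k).cond) (Sum.inr (σ • v))).map
            (((W.residualTauGeomTorsion (p := p) (ConjugationDatum.ofLifts σ hσ₁ hσ τ hτ hτ₂) hm (k := k + 1) k.succ_pos).thetaH1 (Sum.inr v)).comp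
              ((ConjugationDatum.ofLifts σ hσ₁ hσ τ hτ hτ₂).transportH1 ((W.baseChange K).torsionGaloisModule (p : ℤ)) v)) =
          ((W.isQuotientBy_eisensteinDVRSetting_πbar κ hm S hpS hbad L hL hLS jbar (ConjugationDatum.ofLifts σ hσ₁ hσ τ hτ hτ₂) D fs k).propagateStructure (W.eisensteinTowerTriple κ hm S hpS hbad L hL hLS k).cond) (Sum.inr v) := by
  intro k v hvS
  exact W.eisensteinDVRSetting_h5b_clause_of_zero κ hm S hpS hbad L hL hLS jbar (ConjugationDatum.ofLifts σ hσ₁ hσ τ hτ hτ₂)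
    D fs (hfin0 v hvS) k

set_option synthInstance.maxHeartbeats 80000 in
/-- **`SatisfiesH.h5b` for the curve's Eisenstein setting from the LEVEL-`0` clauses at the places of `S`** (canonical
conjugation datum, `σ`-stable `S` containing the places above `p` and the bad places, `K` totally complex): H.5(b) at
tower level `k` — «`τ` carries `F̄(σ v)` onto `F̄(v)`» at EVERY finite place — follows from the clauses
`(θ_v ∘ transport_v)(F̄_0(σ v)) = F̄_0(v)` at `v ∈ S`, tower level `0` (= `eisensteinDVRSetting_h5b_of` ∘
`eisensteinDVRSetting_h5b_hfin_of_zero`; off `S`: x9-p1-w3's unramified clause).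
[cite: Howard2004HeegnerKolyvagin, §1.3 H.5(b) (arXiv p. 7, L96–97), Def. 3.1.2 and §1.6 (arXiv p. 12 L29–55)] -/
theorem eisensteinDVRSetting_h5b_of_zero [NumberField.IsTotallyComplex K]
    (hSσ : ∀ v : HeightOneSpectrum (𝓞 K), σ • v ∈ S → v ∈ S)
    (hfin0 :
    letI := IwasawaAlgebra.isDomain_quotient_X_pow_add_C p hm
    letI := IwasawaAlgebra.isDiscreteValuationRing_quotient_X_pow_add_C p hm
    haveI := IwasawaAlgebra.EisensteinCoeff.isLocalRing_succ p hm
    letI := IwasawaAlgebra.EisensteinCoeff.algebraOfSpecSucc p m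
    haveI := W.isScalarTower_algebraOfSpecSucc (K := K) (p := p) (m := m)
    letI := W.residueModuleSucc (K := K) (p := p) hm
      ∀ v ∈ S,
        (((W.isQuotientBy_eisensteinDVRSetting_πbar κ hm S hpS hbad L hL hLS jbar (ConjugationDatum.ofLifts σ hσ₁ hσ τ hτ hτ₂) D fs 0).propagateStructure (W.eisensteinTowerTriple κ hm S hpS hbad L hL hLS 0).cond) (Sum.inr (σ • v))).map
            (((W.residualTauGeomTorsion (p := p) (ConjugationDatum.ofLifts σ hσ₁ hσ τ hτ hτ₂) hm (k := 0 + 1) (Nat.succ_pos 0)).thetaH1 (Sum.inr v)).comp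
              ((ConjugationDatum.ofLifts σ hσ₁ hσ τ hτ hτ₂).transportH1 ((W.baseChange K).torsionGaloisModule (p : ℤ)) v)) =
          ((W.isQuotientBy_eisensteinDVRSetting_πbar κ hm S hpS hbad L hL hLS jbar (ConjugationDatum.ofLifts σ hσ₁ hσ τ hτ hτ₂) D fs 0).propagateStructure (W.eisensteinTowerTriple κ hm S hpS hbad L hL hLS 0).cond) (Sum.inr v))
    (k : ℕ) :
    letI := IwasawaAlgebra.isDomain_quotient_X_pow_add_C p hm
    letI := IwasawaAlgebra.isDiscreteValuationRing_quotient_X_pow_add_C p hm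
    haveI := IwasawaAlgebra.EisensteinCoeff.isLocalRing_succ p hm
    letI := IwasawaAlgebra.EisensteinCoeff.algebraOfSpecSucc p m
    haveI := W.isScalarTower_algebraOfSpecSucc (K := K) (p := p) (m := m)
    letI := W.residueModuleSucc (K := K) (p := p) hm
    H5b (R := IwasawaAlgebra.EisensteinCoeff p m (k + 1)) ((W.eisensteinTower κ hm).ρ k) (W.isQuotientBy_eisensteinDVRSetting_πbar κ hm S hpS hbad L hL hLS jbar (ConjugationDatum.ofLifts σ hσ₁ hσ τ hτ hτ₂) D fs k) (W.residualTauGeomTorsion (p := p) (ConjugationDatum.ofLifts σ hσ₁ hσ τ hτ hτ₂) hm (k := k + 1) k.succ_pos) (W.eisensteinTowerTriple κ hm S hpS hbad L hL hLS k).cond :=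
  W.eisensteinDVRSetting_h5b_of κ hm S hpS hbad L hL hLS jbar σ hσ₁ hσ τ hτ hτ₂ D fs hSσ
    (W.eisensteinDVRSetting_h5b_hfin_of_zero κ hm S hpS hbad L hL hLS jbar σ hσ₁ hσ τ hτ hτ₂ D fs hfin0) k

end OfLifts

end WeierstrassCurve

end
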